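/-
Copyright (c) 2026. All rights reserved.
Released under Apache 2.0 license as described in the file LICENSE.
-/
import Literature.Probability.LatticeModels.FKGEquality
import Mathlib.Order.Birkhoff
import HarnessLib

/-!
# Equality in the FKG inequality on an arbitrary finite distributive lattice (Chan–Pak 2026, Thm. 1.6)

[ChanPak2026] S. H. Chan and I. Pak, *Equality cases of the Ahlswede–Daykin inequality*, arXiv:2607.06275
(July 2026), Theorem 1.6 ("Equality conditions for the FKG inequality"), verbatim:

> Let `L = (L, ∨, ∧)` be a finite distributive lattice, and let `μ : L → ℝ_{>0}` be a strictly positive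
> log-supermodular function, and let `f, g : L → ℝ` be increasing functions.  Then (FKG) is an equality
> if and only if `L ≃ L₁ × L₂` for some distributive lattices `L₁ = (L₁, ∨′, ∧′)` and `L₂ = (L₂, ∨″, ∧″)`,
> such that `f(x₁, x₂) = f′(x₁)` and `g(x₁, x₂) = g′(x₂)` for all `(x₁, x₂) ∈ L₁ × L₂` (1.4) and
> `μ(x₁, x₂) = μ₁(x₁) μ₂(x₂)` for all `(x₁, x₂) ∈ L` (1.5), for some functions `f′ : L₁ → ℝ`,
> `g′ : L₂ → ℝ`, `μ₁ : L₁ → ℝ_{>0}` and `μ₂ : L₂ → ℝ_{>0}`.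

Here (FKG) is `Σ_x μ(x) f(x) · Σ_x μ(x) g(x) ≤ Σ_x μ(x) f(x) g(x) · Σ_x μ(x)` ([ChanPak2026, Thm. 1.5] =
[FortuinKasteleynGinibre1971, Prop. 1]).  This file proves Theorem 1.6 in this generality
(`fkg_eq_iff_exists_prod`), completing `Literature.Probability.LatticeModels.FKGEquality` (the Boolean lattice
`2^ι`) and `…FKGEqualityChains` (products of chains).  By [ChanPak2026, Remark 1.7] (the support of a
log-supermodular `μ ≥ 0` is a distributive sublattice) this is the full strength of the result.

## Proof route (documented deviation from the printed proof)

Chan–Pak derive Theorem 1.6 from their equality theorem for the Ahlswede–Daykin four functions inequality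
(Thm. 1.3, §§5–9).  As in the companion files we instead read FORTUIN–KASTELEYN–GINIBRE's original induction
[FortuinKasteleynGinibre1971, proof of Prop. 1, pp. 91–93] with equality.  By Birkhoff's representation theorem
(Mathlib's `OrderIso.lowerSetSupIrred`) `L` is the lattice of lower sets of the finite poset `P` of its
join-irreducibles, i.e. the sublattice `𝓛(P) ⊆ 2^P` of down-closed configurations; a strictly positive
log-supermodular weight on `L` is the same as a log-supermodular weight `μ ≥ 0` on `2^P` whose support is
EXACTLY `𝓛(P)`.  The induction of the Boolean file is then run on `2^P` with all statements relativised to the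
support of the weight (`MonoSupp`, `DetSupp`): at a MAXIMAL coordinate `l` of the live set `s` the lower section
`ω ↦ μ(ω ∖ {l})` again has full support `𝓛`, while the upper section `ω ↦ μ(ω ∪ {l})` is supported on the
principal filter `{ω ⊇ ↓l ∖ {l}}` — this is FKG's `Γ_a ⊊ Γ'_a` [FortuinKasteleynGinibre1971, p. 92]; the likelihood
ratio `μ(ω ∪ {l})/μ(ω ∖ {l})` vanishes off that filter and is therefore still increasing on the support, so
Holley's step (2.8)–(2.10) and the three-term decomposition (2.5)–(2.6) (`cov_coord_decomp`, imported) go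
through.  Equality forces one of the two cross factors to vanish (`cross_factor_dichotomy`); for that
function `h ∈ {f, g}` one gets that `h` does not depend on `l` on the support and is uncorrelated with the
ratio under the lower section, the induction hypothesis splits the lower section, the ratio is carried by the
complementary block, and a second application of the induction hypothesis on every fibre (exact identity
`sum_cov_fibre`, imported) finishes (`exists_split_of_cov_eq_zero_supp_aux`).  A splitting set of coordinates is
automatically biclosed in `P` (`Splits.isLowerSet`, `Splits.isUpperSet`), so `𝓛(P) ≅ 𝓛(S) × 𝓛(P ∖ S)`
(`lowerSetProdIso`), which is transported back to `L` (`fkg_eq_iff_exists_prod`).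

## Main statements

* `exists_split_of_cov_eq_zero_supp` — `2^P`, weight `μ ≥ 0` with support the lower sets of `P`.
* `fkg_eq_iff_exists_prod` — [ChanPak2026, Thm. 1.6] verbatim for a finite distributive lattice `L`
  (conclusion: an order isomorphism `L ≃o L₁ × L₂` with `f, g, μ` factoring as printed, `μ₁, μ₂ > 0`).
* `fkg_eq_of_prod` — the converse direction for an arbitrary weight.
-/

open scoped Classical

namespace Literature.Probability.LatticeModels.FKGEqualityLattice

open Finset
open Literature.Combinatorics.Sahi2008 (ex)
open Literature.Probability.LatticeModels.FKGEquality

variable {ι : Type*}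

/-! ### Configurations: the `mix` algebra (re-proved; private in the Boolean file) -/

/-- `mix S ω β ∩ S = ω ∩ S`. [folklore] -/
private theorem mix_inter (S ω β : Set ι) : mix S ω β ∩ S = ω ∩ S := by
  ext e; simp only [mix, Set.mem_inter_iff, Set.mem_union, Set.mem_sdiff]; tauto

/-- `mix S ω β ∖ S = β ∖ S`. [folklore] -/
private theorem mix_diff (S ω β : Set ι) : mix S ω β \ S = β \ S := by
  ext e; simp only [mix, Set.mem_inter_iff, Set.mem_union, Set.mem_sdiff]; tauto

/-- `mix S ω β ∩ Sᶜ = β ∩ Sᶜ`. [folklore] -/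
private theorem mix_inter_compl (S ω β : Set ι) : mix S ω β ∩ Sᶜ = β ∩ Sᶜ := by
  ext e; simp only [mix, Set.mem_inter_iff, Set.mem_union, Set.mem_sdiff, Set.mem_compl_iff]; tauto

/-- `mix S ω ω = ω`. [folklore] -/
private theorem mix_self (S ω : Set ι) : mix S ω ω = ω := by
  ext e; simp only [mix, Set.mem_inter_iff, Set.mem_union, Set.mem_sdiff]; tauto

/-- `mix` is monotone in the `S`-part. [folklore] -/
private theorem mix_mono_left (S : Set ι) {a b : Set ι} (hab : a ⊆ b) (β : Set ι) : mix S a β ⊆ mix S b β := by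
  intro e he
  simp only [mix, Set.mem_inter_iff, Set.mem_union, Set.mem_sdiff] at he ⊢
  rcases he with h | h
  · exact Or.inl ⟨hab h.1, h.2⟩
  · exact Or.inr h

/-- `mix S ω β` only depends on `β ∖ S`. [folklore] -/
private theorem mix_congr_right (S ω : Set ι) {β β' : Set ι} (h : β \ S = β' \ S) : mix S ω β = mix S ω β' := by
  simp only [mix, h]

/-- `mix S (ω ∩ S) β = mix S ω β`. [folklore] -/
private theorem mix_inter_self_left (S ω β : Set ι) : mix S (ω ∩ S) β = mix S ω β := by
  ext e; simp only [mix, Set.mem_inter_iff, Set.mem_union, Set.mem_sdiff]; tauto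

/-- `mix Sᶜ ω β = mix S β ω`. [folklore] -/
private theorem mix_compl (S ω β : Set ι) : mix Sᶜ ω β = mix S β ω := by
  ext e; simp only [mix, Set.mem_inter_iff, Set.mem_union, Set.mem_sdiff, Set.mem_compl_iff]; tauto

/-! ### Vocabulary relativised to the support of the weight -/

/-- `f` is increasing ON THE SUPPORT of `μ` (the lattice `L = supp μ` of [ChanPak2026, Rem. 1.7]).
[cite: ChanPak2026, Thm. 1.6 and Rem. 1.7] -/
def MonoSupp (μ f : Set ι → ℝ) : Prop := ∀ ⦃a b : Set ι⦄, μ a ≠ 0 → μ b ≠ 0 → a ⊆ b → f a ≤ f b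

/-- `f` is determined by the coordinates in `S` ON THE SUPPORT of `μ`: `f(ω) = f(ω ∩ S)` whenever `μ(ω) ≠ 0`
(eq. (1.4): `f(x₁,x₂) = f'(x₁)`). [cite: ChanPak2026, eq. (1.4)] -/
def DetSupp (μ f : Set ι → ℝ) (S : Set ι) : Prop := ∀ ω, μ ω ≠ 0 → f ω = f (ω ∩ S)

/-- A globally `S`-determined function is `S`-determined on any support. [cite: ChanPak2026, eq. (1.4)] -/
theorem detSupp_of_detBy {f : Set ι → ℝ} {S : Set ι} (h : DetBy f S) (μ : Set ι → ℝ) : DetSupp μ f S :=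
  fun ω _ => h ω

/-- The support of a nonnegative log-supermodular weight is closed under `∪` and `∩`
([ChanPak2026, Rem. 1.7]: "`supp(μ)` is a distributive sublattice"). [cite: ChanPak2026, Rem. 1.7] -/
theorem supp_union_inter {μ : Set ι → ℝ} (hμ0 : ∀ ω, 0 ≤ μ ω) (hμ : IsLogSupermodular μ) {a b : Set ι}
    (ha : μ a ≠ 0) (hb : μ b ≠ 0) : μ (a ∪ b) ≠ 0 ∧ μ (a ∩ b) ≠ 0 := by
  have h := hμ a b
  have hab : 0 < μ a * μ b := mul_pos (lt_of_le_of_ne (hμ0 a) (Ne.symm ha)) (lt_of_le_of_ne (hμ0 b) (Ne.symm hb))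
  constructor
  · intro h0
    have : μ (a ⊓ b) * μ (a ⊔ b) = 0 := by rw [show a ⊔ b = a ∪ b from rfl, h0, mul_zero]
    linarith
  · intro h0
    have : μ (a ⊓ b) * μ (a ⊔ b) = 0 := by rw [show a ⊓ b = a ∩ b from rfl, h0, zero_mul]
    linarith

/-- If `μ` splits along `S` and `μ(∅) ≠ 0`, the support is closed under `ω ↦ ω ∩ S` and `ω ↦ ω ∖ S`.
[cite: ChanPak2026, eq. (1.5)] -/
theorem splits_supp_inter_diff {μ : Set ι → ℝ} {S : Set ι} (h : Splits μ S) (h0 : μ ∅ ≠ 0) {ω : Set ι}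
    (hω : μ ω ≠ 0) : μ (ω ∩ S) ≠ 0 ∧ μ (ω \ S) ≠ 0 := by
  have e := h.apply_mul_empty ω
  have : μ (ω ∩ S) * μ (ω \ S) ≠ 0 := by rw [← e]; exact mul_ne_zero hω h0
  exact ⟨left_ne_zero_of_mul this, right_ne_zero_of_mul this⟩

/-- Intersecting determining sets on the support (needs the support to be stable under `· ∩ T`, which
splitting along `T` provides). [cite: ChanPak2026, eq. (1.4)] -/
theorem DetSupp.inter {μ f : Set ι → ℝ} {S T : Set ι} (hS : DetSupp μ f S) (hT : DetSupp μ f T)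
    (hsplit : Splits μ T) (h0 : μ ∅ ≠ 0) : DetSupp μ f (S ∩ T) := by
  intro ω hω
  rw [hT ω hω, hS (ω ∩ T) (splits_supp_inter_diff hsplit h0 hω).1, Set.inter_assoc, Set.inter_comm T S]

/-- Splitting is symmetric in `S ↔ Sᶜ`. [cite: ChanPak2026, eq. (1.5)] -/
theorem splits_compl {μ : Set ι → ℝ} {S : Set ι} (h : Splits μ S) : Splits μ Sᶜ := by
  intro ω β
  rw [mix_compl, mix_compl, h ω β, mul_comm]

/-- A weight determined by `s` that splits along `A` splits along `A ∩ s`. [cite: ChanPak2026, eq. (1.5)] -/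
theorem splits_inter_of_detBy {μ : Set ι → ℝ} {A s : Set ι} (h : Splits μ A) (hs : DetBy μ s) :
    Splits μ (A ∩ s) := by
  have key : ∀ ω β, mix (A ∩ s) ω β ∩ s = mix A ω β ∩ s := fun ω β => by
    ext e; simp only [mix, Set.mem_inter_iff, Set.mem_union, Set.mem_sdiff]; tauto
  intro ω β
  rw [hs (mix (A ∩ s) ω β), hs (mix (A ∩ s) β ω), key, key, ← hs, ← hs, h ω β]

/-- Multiplying a weight that splits along `S` by a factor that is `Sᶜ`-determined ON ITS SUPPORT preserves
splitting. [cite: ChanPak2026, eq. (1.5) and (9.7)] -/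
theorem splits_mul_detSupp_compl {A B : Set ι → ℝ} {S : Set ι} (hA : Splits A S) (hB : DetSupp A B Sᶜ) :
    Splits (fun ω => A ω * B ω) S := by
  intro ω β
  dsimp only
  by_cases hω : A ω = 0
  · have : A (mix S ω β) * A (mix S β ω) = 0 := by rw [← hA ω β, hω, zero_mul]
    rw [hω, zero_mul, zero_mul, mul_mul_mul_comm, this, zero_mul]
  by_cases hβ : A β = 0
  · have : A (mix S ω β) * A (mix S β ω) = 0 := by rw [← hA ω β, hβ, mul_zero]
    rw [hβ, zero_mul, mul_zero, mul_mul_mul_comm, this, zero_mul]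
  have hprod : A (mix S ω β) * A (mix S β ω) ≠ 0 := by rw [← hA ω β]; exact mul_ne_zero hω hβ
  have h1 : B (mix S ω β) = B β := by
    rw [hB _ (left_ne_zero_of_mul hprod), mix_inter_compl, ← hB β hβ]
  have h2 : B (mix S β ω) = B ω := by
    rw [hB _ (right_ne_zero_of_mul hprod), mix_inter_compl, ← hB ω hω]
  rw [h1, h2, mul_mul_mul_comm, hA ω β]
  ring

/-- **Splitting sets are closed under intersection** whenever `μ(∅) ≠ 0` (four-block product representation;
the Boolean file's `Splits.inter` assumed `μ > 0`). [cite: ChanPak2026, eq. (9.7)] -/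
theorem splits_inter {μ : Set ι → ℝ} (h0' : μ ∅ ≠ 0) {S T : Set ι} (hS : Splits μ S) (hT : Splits μ T) :
    Splits μ (S ∩ T) := by
  have rep : ∀ ω, μ ω * μ ∅ ^ 3 =
      μ (ω ∩ T ∩ S) * μ ((ω ∩ T) \ S) * (μ ((ω \ T) ∩ S) * μ ((ω \ T) \ S)) := fun ω => by
    have h1 := hT.apply_mul_empty ω
    have h2 := hS.apply_mul_empty (ω ∩ T)
    have h3 := hS.apply_mul_empty (ω \ T)
    calc μ ω * μ ∅ ^ 3 = (μ ω * μ ∅) * μ ∅ * μ ∅ := by ring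
      _ = (μ (ω ∩ T) * μ ∅) * (μ (ω \ T) * μ ∅) := by rw [h1]; ring
      _ = _ := by rw [h2, h3]
  have h0 : μ ∅ ^ 3 ≠ 0 := pow_ne_zero 3 h0'
  intro ω β
  have e1 : mix (S ∩ T) ω β ∩ T ∩ S = ω ∩ T ∩ S := by
    ext e; simp only [mix, Set.mem_inter_iff, Set.mem_union, Set.mem_sdiff]; tauto
  have e2 : (mix (S ∩ T) ω β ∩ T) \ S = (β ∩ T) \ S := by
    ext e; simp only [mix, Set.mem_inter_iff, Set.mem_union, Set.mem_sdiff]; tauto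
  have e3 : (mix (S ∩ T) ω β \ T) ∩ S = (β \ T) ∩ S := by
    ext e; simp only [mix, Set.mem_inter_iff, Set.mem_union, Set.mem_sdiff]; tauto
  have e4 : (mix (S ∩ T) ω β \ T) \ S = (β \ T) \ S := by
    ext e; simp only [mix, Set.mem_inter_iff, Set.mem_union, Set.mem_sdiff]; tauto
  have e5 : mix (S ∩ T) β ω ∩ T ∩ S = β ∩ T ∩ S := by
    ext e; simp only [mix, Set.mem_inter_iff, Set.mem_union, Set.mem_sdiff]; tauto
  have e6 : (mix (S ∩ T) β ω ∩ T) \ S = (ω ∩ T) \ S := by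
    ext e; simp only [mix, Set.mem_inter_iff, Set.mem_union, Set.mem_sdiff]; tauto
  have e7 : (mix (S ∩ T) β ω \ T) ∩ S = (ω \ T) ∩ S := by
    ext e; simp only [mix, Set.mem_inter_iff, Set.mem_union, Set.mem_sdiff]; tauto
  have e8 : (mix (S ∩ T) β ω \ T) \ S = (ω \ T) \ S := by
    ext e; simp only [mix, Set.mem_inter_iff, Set.mem_union, Set.mem_sdiff]; tauto
  have key : (μ ω * μ ∅ ^ 3) * (μ β * μ ∅ ^ 3) =
      (μ (mix (S ∩ T) ω β) * μ ∅ ^ 3) * (μ (mix (S ∩ T) β ω) * μ ∅ ^ 3) := by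
    rw [rep ω, rep β, rep (mix (S ∩ T) ω β), rep (mix (S ∩ T) β ω), e1, e2, e3, e4, e5, e6, e7, e8]
    ring
  have : (μ ω * μ β) * (μ ∅ ^ 3 * μ ∅ ^ 3) =
      (μ (mix (S ∩ T) ω β) * μ (mix (S ∩ T) β ω)) * (μ ∅ ^ 3 * μ ∅ ^ 3) := by
    calc (μ ω * μ β) * (μ ∅ ^ 3 * μ ∅ ^ 3) = (μ ω * μ ∅ ^ 3) * (μ β * μ ∅ ^ 3) := by ring
      _ = _ := key
      _ = _ := by ring
  exact mul_right_cancel₀ (mul_ne_zero h0 h0) this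

variable [Fintype ι]

/-- Two functions that agree on the support have the same covariances. [cite: FortuinKasteleynGinibre1971, eq. (2.4)] -/
theorem cov_congr_supp {μ f f' : Set ι → ℝ} (h : ∀ ω, μ ω ≠ 0 → f ω = f' ω) (g : Set ι → ℝ) :
    cov μ f g = cov μ f' g := by
  have pt : ∀ (k : Set ι → ℝ) ω, μ ω * (f ω * k ω) = μ ω * (f' ω * k ω) := fun k ω => by
    by_cases hω : μ ω = 0
    · rw [hω, zero_mul, zero_mul]
    · rw [h ω hω]
  have e1 : ex μ (f * g) = ex μ (f' * g) := by
    simp only [ex, Pi.mul_apply]; exact sum_congr rfl fun ω _ => pt g ω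
  have e2 : ex μ f = ex μ f' := by
    simp only [ex]
    refine sum_congr rfl fun ω _ => ?_
    have := pt (fun _ => 1) ω
    simpa only [mul_one] using this
  rw [cov, cov, e1, e2]

/-- **FKG on the support**: for a nonnegative log-supermodular weight on `2^ι` and two functions increasing on
its support, `Ω(f,g) ≥ 0` ([ChanPak2026, Thm. 1.5] on the sublattice `supp μ`, via Mathlib's
`four_functions_theorem_univ`). [cite: ChanPak2026, Thm. 1.5 and Rem. 1.7; FortuinKasteleynGinibre1971, Prop. 1] -/
theorem cov_nonneg_supp {μ f g : Set ι → ℝ} (hμ0 : ∀ ω, 0 ≤ μ ω) (hμ : IsLogSupermodular μ)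
    (hf : MonoSupp μ f) (hg : MonoSupp μ g) : 0 ≤ cov μ f g := by
  obtain ⟨a₀, -, ha₀⟩ := exists_min_image univ f univ_nonempty
  obtain ⟨b₀, -, hb₀⟩ := exists_min_image univ g univ_nonempty
  rw [← cov_sub_const μ f g (f a₀) (g b₀), cov, sub_nonneg]
  have hf0 : ∀ ω, 0 ≤ f ω - f a₀ := fun ω => sub_nonneg.2 (ha₀ ω (mem_univ ω))
  have hg0 : ∀ ω, 0 ≤ g ω - g b₀ := fun ω => sub_nonneg.2 (hb₀ ω (mem_univ ω))
  have h := four_functions_theorem_univ (fun ω => μ ω * (f ω - f a₀)) (fun ω => μ ω * (g ω - g b₀)) μ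
    (fun ω => μ ω * ((f ω - f a₀) * (g ω - g b₀))) (fun ω => mul_nonneg (hμ0 ω) (hf0 ω))
    (fun ω => mul_nonneg (hμ0 ω) (hg0 ω)) (fun ω => hμ0 ω)
    (fun ω => mul_nonneg (hμ0 ω) (mul_nonneg (hf0 ω) (hg0 ω))) (fun a b => ?_)
  · simpa only [ex, Pi.mul_apply] using h
  · by_cases ha : μ a = 0
    · rw [ha, zero_mul, zero_mul]
      exact mul_nonneg (hμ0 _) (mul_nonneg (hμ0 _) (mul_nonneg (hf0 _) (hg0 _)))
    by_cases hb : μ b = 0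
    · rw [hb, zero_mul, mul_zero]
      exact mul_nonneg (hμ0 _) (mul_nonneg (hμ0 _) (mul_nonneg (hf0 _) (hg0 _)))
    have hab := (supp_union_inter hμ0 hμ ha hb).1
    have hfa : f a - f a₀ ≤ f (a ∪ b) - f a₀ := sub_le_sub_right (hf ha hab Set.subset_union_left) _
    have hgb : g b - g b₀ ≤ g (a ∪ b) - g b₀ := sub_le_sub_right (hg hb hab Set.subset_union_right) _
    calc μ a * (f a - f a₀) * (μ b * (g b - g b₀))
        = (μ a * μ b) * ((f a - f a₀) * (g b - g b₀)) := by ring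
      _ ≤ (μ (a ⊓ b) * μ (a ⊔ b)) * ((f (a ∪ b) - f a₀) * (g (a ∪ b) - g b₀)) :=
          mul_le_mul (hμ a b) (mul_le_mul hfa hgb (hg0 b) (hf0 _)) (mul_nonneg (hf0 a) (hg0 b))
            (mul_nonneg (hμ0 _) (hμ0 _))
      _ = μ (a ⊓ b) * (μ (a ⊔ b) * ((f (a ⊔ b) - f a₀) * (g (a ⊔ b) - g b₀))) := by
          rw [show a ⊔ b = a ∪ b from rfl]; ring


/-! ### Sections at a coordinate whose removal preserves the support (FKG's `Γ'_a`, `Γ''_a`, `Γ_a ⊊ Γ'_a`) -/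

section Sections

omit [Fintype ι]

/-- Unfolding `upSec`. [folklore] -/
private theorem upSec_eq (l : ι) (h : Set ι → ℝ) (ω : Set ι) : upSec l h ω = h (insert l ω) := rfl

/-- Unfolding `dnSec`. [folklore] -/
private theorem dnSec_eq (l : ι) (h : Set ι → ℝ) (ω : Set ι) : dnSec l h ω = h (ω \ {l}) := rfl

/-- Unfolding `ratio`. [folklore] -/
private theorem ratio_eq (l : ι) (μ : Set ι → ℝ) (ω : Set ι) : ratio l μ ω = upSec l μ ω / dnSec l μ ω := rfl

/-- `(insert l ω) ∖ {l} = ω ∖ {l}`. [folklore] -/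
private theorem insert_diff_self (l : ι) (ω : Set ι) : insert l ω \ {l} = ω \ {l} := by
  ext e; simp only [Set.mem_sdiff, Set.mem_insert_iff, Set.mem_singleton_iff]; tauto

/-- `(a ∖ {l}) ∩ (b ∖ {l}) = (a ∩ b) ∖ {l}`. [folklore] -/
private theorem diff_inter_diff (l : ι) (a b : Set ι) : (a \ {l}) ∩ (b \ {l}) = (a ∩ b) \ {l} := by
  ext e; simp only [Set.mem_sdiff, Set.mem_inter_iff]; tauto

/-- `(a ∖ {l}) ∪ (b ∖ {l}) = (a ∪ b) ∖ {l}`. [folklore] -/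
private theorem diff_union_diff (l : ι) (a b : Set ι) : (a \ {l}) ∪ (b \ {l}) = (a ∪ b) \ {l} := by
  ext e; simp only [Set.mem_sdiff, Set.mem_union]; tauto

/-- The upper section of a log-supermodular weight is log-supermodular. [cite: FortuinKasteleynGinibre1971, eq. (2.9)] -/
theorem isLogSupermodular_upSec {μ : Set ι → ℝ} (hμ : IsLogSupermodular μ) (l : ι) :
    IsLogSupermodular (upSec l μ) := by
  intro a b
  have h : μ (insert l a) * μ (insert l b) ≤ μ (insert l a ∩ insert l b) * μ (insert l a ∪ insert l b) := hμ _ _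
  rw [← Set.insert_inter_distrib, ← Set.insert_union_distrib] at h
  exact h

/-- The lower section of a log-supermodular weight is log-supermodular. [cite: FortuinKasteleynGinibre1971, eq. (2.9)] -/
theorem isLogSupermodular_dnSec {μ : Set ι → ℝ} (hμ : IsLogSupermodular μ) (l : ι) :
    IsLogSupermodular (dnSec l μ) := by
  intro a b
  have h : μ (a \ {l}) * μ (b \ {l}) ≤ μ ((a \ {l}) ∩ (b \ {l})) * μ ((a \ {l}) ∪ (b \ {l})) := hμ _ _
  rw [diff_inter_diff, diff_union_diff] at h
  exact h

/-- The lower section of an `S`-determined function is `(S ∖ {l})`-determined. [folklore] -/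
private theorem detBy_dnSec {h : Set ι → ℝ} {S : Set ι} (hS : DetBy h S) (l : ι) : DetBy (dnSec l h) (S \ {l}) := by
  intro ω
  simp only [dnSec_eq]
  rw [hS (ω \ {l}), hS ((ω ∩ (S \ {l})) \ {l})]
  congr 1
  ext e; simp only [Set.mem_sdiff, Set.mem_inter_iff, Set.mem_singleton_iff]; tauto

/-- The upper section of an `S`-determined function is `(S ∖ {l})`-determined. [folklore] -/
private theorem detBy_upSec {h : Set ι → ℝ} {S : Set ι} (hS : DetBy h S) (l : ι) : DetBy (upSec l h) (S \ {l}) := by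
  intro ω
  simp only [upSec_eq]
  rw [hS (insert l ω), hS (insert l (ω ∩ (S \ {l})))]
  congr 1
  ext e
  simp only [Set.mem_sdiff, Set.mem_inter_iff, Set.mem_singleton_iff, Set.mem_insert_iff]
  by_cases hel : e = l
  · subst hel; tauto
  · tauto

/-- The section ratio of an `S`-determined weight is `(S ∖ {l})`-determined. [folklore] -/
private theorem detBy_ratio {μ : Set ι → ℝ} {S : Set ι} (hS : DetBy μ S) (l : ι) : DetBy (ratio l μ) (S \ {l}) :=
  DetBy.map₂ (detBy_upSec hS l) (detBy_dnSec hS l) (· / ·)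

variable {μ : Set ι → ℝ} {l : ι}

/-- If removing `l` preserves the support, the support of the upper section is contained in that of the lower
section (FKG's `Γ_a ⊆ Γ'_a`, here at a maximal join-irreducible). [cite: FortuinKasteleynGinibre1971, proof of Prop. 1 (p. 92)] -/
theorem dnSec_ne_zero_of_upSec (hl : ∀ ω, μ ω ≠ 0 → μ (ω \ {l}) ≠ 0) {ω : Set ι} (hω : upSec l μ ω ≠ 0) :
    dnSec l μ ω ≠ 0 := by
  rw [dnSec_eq, ← insert_diff_self]
  exact hl _ hω

/-- Lower sections of support-increasing functions are support-increasing. [folklore] -/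
private theorem monoSupp_dnSec {f : Set ι → ℝ} (hf : MonoSupp μ f) (l : ι) : MonoSupp (dnSec l μ) (dnSec l f) :=
  fun _ _ ha hb hab => hf ha hb (Set.sdiff_subset_sdiff_left hab)

/-- Upper sections of support-increasing functions are support-increasing. [folklore] -/
private theorem monoSupp_upSec {f : Set ι → ℝ} (hf : MonoSupp μ f) (l : ι) : MonoSupp (upSec l μ) (upSec l f) :=
  fun _ _ ha hb hab => hf ha hb (Set.insert_subset_insert hab)

/-- `f(ω ∖ {l}) ≤ f(ω ∪ {l})` on the support of the upper section. [folklore] -/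
private theorem dnSec_le_upSec_supp {f : Set ι → ℝ} (hf : MonoSupp μ f) (hl : ∀ ω, μ ω ≠ 0 → μ (ω \ {l}) ≠ 0)
    {ω : Set ι} (hω : upSec l μ ω ≠ 0) : dnSec l f ω ≤ upSec l f ω :=
  hf (dnSec_ne_zero_of_upSec hl hω) hω (Set.sdiff_subset.trans (Set.subset_insert l ω))

/-- The section ratio `μ(ω ∪ {l})/μ(ω ∖ {l})` is increasing on the support of the lower section — also when the
upper section has smaller support, since the ratio vanishes off an up-set there
(FKG: "`μ/μ_a` is decreasing on `Γ_a`"). [cite: FortuinKasteleynGinibre1971, eq. (2.9)–(2.10)] -/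
theorem monoSupp_ratio (hμ0 : ∀ ω, 0 ≤ μ ω) (hμ : IsLogSupermodular μ) (l : ι) :
    MonoSupp (dnSec l μ) (ratio l μ) := by
  intro a b ha hb hab
  have ha' : 0 < dnSec l μ a := lt_of_le_of_ne (hμ0 _) (Ne.symm ha)
  have hb' : 0 < dnSec l μ b := lt_of_le_of_ne (hμ0 _) (Ne.symm hb)
  rw [ratio_eq, ratio_eq, div_le_div_iff₀ ha' hb']
  have h := upSec_mul_dnSec_le hμ l a b
  rw [Set.inter_eq_left.2 hab, Set.union_eq_right.2 hab] at h
  exact h.trans_eq (mul_comm _ _)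

/-- `μ = μ(· ∖ {l}) · (ratio)^{[l ∈ ω]}` pointwise, when removing `l` preserves the support. [folklore] -/
private theorem eq_dnSec_mul_ratio (hl : ∀ ω, μ ω ≠ 0 → μ (ω \ {l}) ≠ 0) :
    μ = fun ω => dnSec l μ ω * (if l ∈ ω then ratio l μ ω else 1) := by
  funext ω
  by_cases hlω : l ∈ ω
  · simp only [if_pos hlω, ratio_eq, dnSec_eq, upSec_eq, Set.insert_eq_of_mem hlω]
    by_cases h0 : μ (ω \ {l}) = 0
    · have : μ ω = 0 := by
        by_contra hne
        exact hl ω hne h0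
      rw [this, h0, zero_mul]
    · rw [mul_div_cancel₀ _ h0]
  · simp only [if_neg hlω, dnSec_eq, mul_one, Set.sdiff_singleton_eq_self hlω]

variable [Fintype ι]

/-- **Holley's inequality between the two sections, on the support** (FKG's (2.8)–(2.10)): for `k` increasing on
the support of the lower section, `P₁ · Σ μ₀ k ≤ P₀ · Σ μ₁ k`.  Four functions theorem; the case where the upper
section vanishes is where `Γ_a ⊊ Γ'_a` enters. [cite: FortuinKasteleynGinibre1971, eqs. (2.8)–(2.10)] -/
theorem holley_sections_supp (hμ0 : ∀ ω, 0 ≤ μ ω) (hμ : IsLogSupermodular μ)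
    (hl : ∀ ω, μ ω ≠ 0 → μ (ω \ {l}) ≠ 0) {k : Set ι → ℝ} (hk : MonoSupp (dnSec l μ) k) :
    (∑ ω, upSec l μ ω) * ex (dnSec l μ) k ≤ (∑ ω, dnSec l μ ω) * ex (upSec l μ) k := by
  obtain ⟨a₀, -, ha₀⟩ := exists_min_image univ k univ_nonempty
  have hk'0 : ∀ ω, 0 ≤ k ω - k a₀ := fun ω => sub_nonneg.2 (ha₀ ω (mem_univ ω))
  have hup0 : ∀ ω, 0 ≤ upSec l μ ω := fun ω => hμ0 _
  have hdn0 : ∀ ω, 0 ≤ dnSec l μ ω := fun ω => hμ0 _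
  have h := four_functions_theorem_univ (upSec l μ) (fun ω => dnSec l μ ω * (k ω - k a₀)) (dnSec l μ)
    (fun ω => upSec l μ ω * (k ω - k a₀)) hup0 (fun ω => mul_nonneg (hdn0 ω) (hk'0 ω)) hdn0
    (fun ω => mul_nonneg (hup0 ω) (hk'0 ω)) (fun a b => ?_)
  · have e1 : ex (dnSec l μ) k = (∑ ω, dnSec l μ ω * (k ω - k a₀)) + k a₀ * ∑ ω, dnSec l μ ω := by
      rw [ex, mul_sum, ← sum_add_distrib]; exact sum_congr rfl fun ω _ => by ring
    have e2 : ex (upSec l μ) k = (∑ ω, upSec l μ ω * (k ω - k a₀)) + k a₀ * ∑ ω, upSec l μ ω := by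
      rw [ex, mul_sum, ← sum_add_distrib]; exact sum_congr rfl fun ω _ => by ring
    rw [e1, e2]
    nlinarith [h]
  · show upSec l μ a * (dnSec l μ b * (k b - k a₀)) ≤ dnSec l μ (a ⊓ b) * (upSec l μ (a ⊔ b) * (k (a ⊔ b) - k a₀))
    have hH := upSec_mul_dnSec_le hμ l a b
    by_cases hb : dnSec l μ b = 0
    · rw [hb, zero_mul, mul_zero]
      exact mul_nonneg (hdn0 _) (mul_nonneg (hup0 _) (hk'0 _))
    by_cases hab : upSec l μ (a ∪ b) = 0
    · have hz : upSec l μ a * dnSec l μ b = 0 :=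
        le_antisymm (by rw [hab, mul_zero] at hH; exact hH) (mul_nonneg (hup0 _) (hdn0 _))
      calc upSec l μ a * (dnSec l μ b * (k b - k a₀)) = (upSec l μ a * dnSec l μ b) * (k b - k a₀) := by ring
        _ = 0 := by rw [hz, zero_mul]
        _ ≤ _ := mul_nonneg (hdn0 _) (mul_nonneg (hup0 _) (hk'0 _))
    have hkb : k b - k a₀ ≤ k (a ∪ b) - k a₀ :=
      sub_le_sub_right (hk hb (dnSec_ne_zero_of_upSec hl hab) Set.subset_union_right) _
    calc upSec l μ a * (dnSec l μ b * (k b - k a₀)) = (upSec l μ a * dnSec l μ b) * (k b - k a₀) := by ring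
      _ ≤ (dnSec l μ (a ∩ b) * upSec l μ (a ∪ b)) * (k (a ∪ b) - k a₀) :=
          mul_le_mul hH hkb (hk'0 b) (mul_nonneg (hdn0 _) (hup0 _))
      _ = dnSec l μ (a ⊓ b) * (upSec l μ (a ⊔ b) * (k (a ⊔ b) - k a₀)) := by
          rw [show a ⊓ b = a ∩ b from rfl, show a ⊔ b = a ∪ b from rfl]; ring

/-- **The cross term forces one factor to vanish** (equality case of FKG's (2.6)–(2.10) at the coordinate `l`,
support version): if `Ω(f,g) = 0` then for `h = f` or for `h = g`, `h` does not depend on `l` on the support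
of the upper section AND `h(· ∖ {l})` is uncorrelated with the section ratio under the lower section.
[cite: FortuinKasteleynGinibre1971, eqs. (2.5)–(2.10); ChanPak2026, Thm. 1.6] -/
theorem cross_factor_dichotomy {f g : Set ι → ℝ} (hμ0 : ∀ ω, 0 ≤ μ ω) (hμ : IsLogSupermodular μ)
    (hl : ∀ ω, μ ω ≠ 0 → μ (ω \ {l}) ≠ 0) (hf : MonoSupp μ f) (hg : MonoSupp μ g) (hcov : cov μ f g = 0) :
    ((∀ ω, upSec l μ ω ≠ 0 → upSec l f ω = dnSec l f ω) ∧ cov (dnSec l μ) (dnSec l f) (ratio l μ) = 0) ∨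
    ((∀ ω, upSec l μ ω ≠ 0 → upSec l g ω = dnSec l g ω) ∧ cov (dnSec l μ) (dnSec l g) (ratio l μ) = 0) := by
  have hup0 : ∀ ω, 0 ≤ upSec l μ ω := fun ω => hμ0 _
  have hdn0 : ∀ ω, 0 ≤ dnSec l μ ω := fun ω => hμ0 _
  obtain ⟨P0, hP0⟩ : ∃ x : ℝ, x = ∑ ω, dnSec l μ ω := ⟨_, rfl⟩
  obtain ⟨P1, hP1⟩ : ∃ x : ℝ, x = ∑ ω, upSec l μ ω := ⟨_, rfl⟩
  -- the identities `Σ μ₀ (h₀ · ρ) = Σ μ₁ h₀` and `Σ μ₀ ρ = P₁`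
  have exρ : ∀ h : Set ι → ℝ, ex (dnSec l μ) (dnSec l h * ratio l μ) = ex (upSec l μ) (dnSec l h) := by
    intro h
    simp only [ex, Pi.mul_apply, ratio_eq]
    refine sum_congr rfl fun ω _ => ?_
    by_cases hne : dnSec l μ ω = 0
    · have : upSec l μ ω = 0 := by
        by_contra hup
        exact dnSec_ne_zero_of_upSec hl hup hne
      rw [hne, this, zero_mul, zero_mul]
    · calc dnSec l μ ω * (dnSec l h ω * (upSec l μ ω / dnSec l μ ω))
          = (dnSec l μ ω * (upSec l μ ω / dnSec l μ ω)) * dnSec l h ω := by ring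
        _ = upSec l μ ω * dnSec l h ω := by rw [mul_div_cancel₀ _ hne]
  have exρ1 : ex (dnSec l μ) (ratio l μ) = P1 := by
    have := exρ (fun _ => 1)
    simp only [ex, Pi.mul_apply, dnSec_eq, one_mul, mul_one] at this
    rw [hP1, ex]
    simpa only [dnSec_eq] using this
  have covY : ∀ h : Set ι → ℝ, cov (dnSec l μ) (dnSec l h) (ratio l μ) =
      P0 * ex (upSec l μ) (dnSec l h) - P1 * ex (dnSec l μ) (dnSec l h) := by
    intro h
    rw [cov, exρ, exρ1, ← hP0]
    ring
  -- degenerate case: the upper section vanishes identically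
  by_cases hP1z : P1 = 0
  · have hupz : ∀ ω, upSec l μ ω = 0 := fun ω =>
      (sum_eq_zero_iff_of_nonneg (fun ω _ => hup0 ω)).1 (hP1 ▸ hP1z) ω (mem_univ ω)
    left
    refine ⟨fun ω hω => absurd (hupz ω) hω, ?_⟩
    rw [covY, hP1z, zero_mul, sub_zero]
    have : ex (upSec l μ) (dnSec l f) = 0 := by
      simp only [ex]; exact sum_eq_zero fun ω _ => by rw [hupz ω, zero_mul]
    rw [this, mul_zero]
  have hP1pos : 0 < P1 := lt_of_le_of_ne (hP1 ▸ sum_nonneg fun ω _ => hup0 ω) (Ne.symm hP1z)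
  have hP0pos : 0 < P0 := by
    obtain ⟨ω₁, -, hω₁⟩ : ∃ ω ∈ (univ : Finset (Set ι)), upSec l μ ω ≠ 0 := by
      by_contra hcon
      push Not at hcon
      exact hP1z (by rw [hP1]; exact sum_eq_zero fun ω hω => hcon ω hω)
    rw [hP0]
    exact sum_pos' (fun ω _ => hdn0 ω)
      ⟨ω₁, mem_univ _, lt_of_le_of_ne (hdn0 _) (Ne.symm (dnSec_ne_zero_of_upSec hl hω₁))⟩
  -- the two cross factors of a support-increasing `h`
  have hX0 : ∀ h : Set ι → ℝ, MonoSupp μ h → 0 ≤ ∑ ω, upSec l μ ω * (upSec l h ω - dnSec l h ω) := by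
    intro h hh
    refine sum_nonneg fun ω _ => ?_
    by_cases hω : upSec l μ ω = 0
    · rw [hω, zero_mul]
    · exact mul_nonneg (hup0 ω) (sub_nonneg.2 (dnSec_le_upSec_supp hh hl hω))
  have hY0 : ∀ h : Set ι → ℝ, MonoSupp μ h → 0 ≤ P0 * ex (upSec l μ) (dnSec l h) - P1 * ex (dnSec l μ) (dnSec l h) := by
    intro h hh
    rw [hP0, hP1]
    exact sub_nonneg.2 (holley_sections_supp hμ0 hμ hl (monoSupp_dnSec hh l))
  have hsplit : ∀ h : Set ι → ℝ, P0 * ex (upSec l μ) (upSec l h) - P1 * ex (dnSec l μ) (dnSec l h) =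
      P0 * (∑ ω, upSec l μ ω * (upSec l h ω - dnSec l h ω)) +
        (P0 * ex (upSec l μ) (dnSec l h) - P1 * ex (dnSec l μ) (dnSec l h)) := by
    intro h
    have : ex (upSec l μ) (upSec l h) = (∑ ω, upSec l μ ω * (upSec l h ω - dnSec l h ω)) +
        ex (upSec l μ) (dnSec l h) := by
      simp only [ex]; rw [← sum_add_distrib]; exact sum_congr rfl fun ω _ => by ring
    rw [this]; ring
  -- what the vanishing of a cross factor gives
  have key : ∀ h : Set ι → ℝ, MonoSupp μ h →
      P0 * (∑ ω, upSec l μ ω * (upSec l h ω - dnSec l h ω)) +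
        (P0 * ex (upSec l μ) (dnSec l h) - P1 * ex (dnSec l μ) (dnSec l h)) = 0 →
      (∀ ω, upSec l μ ω ≠ 0 → upSec l h ω = dnSec l h ω) ∧ cov (dnSec l μ) (dnSec l h) (ratio l μ) = 0 := by
    intro h hh hz
    have hx := hX0 h hh
    have hy := hY0 h hh
    have hXz : ∑ ω, upSec l μ ω * (upSec l h ω - dnSec l h ω) = 0 := by nlinarith [mul_nonneg hP0pos.le hx]
    have hYz : P0 * ex (upSec l μ) (dnSec l h) - P1 * ex (dnSec l μ) (dnSec l h) = 0 := by nlinarith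
    constructor
    · intro ω hω
      have hterm := (sum_eq_zero_iff_of_nonneg fun ω _ => ?_).1 hXz ω (mem_univ ω)
      · rcases mul_eq_zero.1 hterm with h1 | h1
        · exact absurd h1 hω
        · linarith
      · by_cases hω' : upSec l μ ω = 0
        · rw [hω', zero_mul]
        · exact mul_nonneg (hup0 ω) (sub_nonneg.2 (dnSec_le_upSec_supp hh hl hω'))
    · rw [covY]; exact hYz
  -- FKG's decomposition with `Ω = 0`: the product of the two cross factors vanishes
  have hA : 0 ≤ cov (dnSec l μ) (dnSec l f) (dnSec l g) :=
    cov_nonneg_supp hdn0 (isLogSupermodular_dnSec hμ l) (monoSupp_dnSec hf l) (monoSupp_dnSec hg l)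
  have hB : 0 ≤ cov (upSec l μ) (upSec l f) (upSec l g) :=
    cov_nonneg_supp hup0 (isLogSupermodular_upSec hμ l) (monoSupp_upSec hf l) (monoSupp_upSec hg l)
  have hdec := cov_coord_decomp μ f g l
  rw [hcov, mul_zero, ← hP0, ← hP1, hsplit f, hsplit g] at hdec
  obtain ⟨Ff, hFf⟩ : ∃ x : ℝ, x = P0 * (∑ ω, upSec l μ ω * (upSec l f ω - dnSec l f ω)) +
      (P0 * ex (upSec l μ) (dnSec l f) - P1 * ex (dnSec l μ) (dnSec l f)) := ⟨_, rfl⟩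
  obtain ⟨Fg, hFg⟩ : ∃ x : ℝ, x = P0 * (∑ ω, upSec l μ ω * (upSec l g ω - dnSec l g ω)) +
      (P0 * ex (upSec l μ) (dnSec l g) - P1 * ex (dnSec l μ) (dnSec l g)) := ⟨_, rfl⟩
  have hFf0 : 0 ≤ Ff := hFf ▸ add_nonneg (mul_nonneg hP0pos.le (hX0 f hf)) (hY0 f hf)
  have hFg0 : 0 ≤ Fg := hFg ▸ add_nonneg (mul_nonneg hP0pos.le (hX0 g hg)) (hY0 g hg)
  rw [← hFf, ← hFg] at hdec
  have hcross : Ff * Fg = 0 := by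
    nlinarith [mul_nonneg (mul_nonneg hP1pos.le (add_nonneg hP0pos.le hP1pos.le)) hA,
      mul_nonneg (mul_nonneg hP0pos.le (add_nonneg hP0pos.le hP1pos.le)) hB, mul_nonneg hFf0 hFg0]
  rcases mul_eq_zero.1 hcross with hz | hz
  · exact Or.inl (key f hf (hFf ▸ hz))
  · exact Or.inr (key g hg (hFg ▸ hz))

end Sections


/-! ### The induction over the live coordinates of a finite poset -/

section Poset

variable {P : Type*} [PartialOrder P]

/-- `D` is down-closed with respect to the coordinates in `s`: `p ∈ s`, `p ≤ q ∈ D ⇒ p ∈ D`.  The support of the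
weights in the induction is `{ω : ω ∩ s is down-closed in s}` — the lattice of lower sets of the sub-poset `s`
(Birkhoff: the finite distributive lattice with poset of join-irreducibles `s`). [cite: ChanPak2026, §1.3 and Rem. 1.7] -/
def IsLowerIn (s D : Set P) : Prop := ∀ ⦃p q : P⦄, p ∈ s → p ≤ q → q ∈ D → p ∈ D

variable [Fintype P]

/-- **Main lemma (support version of the Boolean file's induction).**  For a nonnegative log-supermodular
weight `μ` on `2^P` whose support is exactly the set of configurations down-closed inside the live set `s`,
and `f, g` increasing on the support, all determined by `s`: `Ω(f,g) = 0` forces `S ⊆ s` with `f` determined by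
`S` and `g` by `Sᶜ` on the support, and `μ` splitting along `S`.  Induction on `s`; the step is taken at a
MAXIMAL element `l` of `s` (so that removing `l` preserves the support), with FKG's three-term decomposition,
Holley's step for the possibly smaller upper block, the dichotomy `cross_factor_dichotomy`, the induction
hypothesis for the lower section against the section ratio, and a second use of the induction hypothesis on
every fibre off the splitting set. [cite: ChanPak2026, Thm. 1.6; FortuinKasteleynGinibre1971, proof of Prop. 1] -/
theorem exists_split_of_cov_eq_zero_supp_aux (s : Finset P) :
    ∀ (μ f g : Set P → ℝ), (∀ ω, 0 ≤ μ ω) → (∀ ω, μ ω ≠ 0 ↔ IsLowerIn ↑s (ω ∩ ↑s)) → IsLogSupermodular μ →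
      MonoSupp μ f → MonoSupp μ g → DetBy μ ↑s → DetBy f ↑s → DetBy g ↑s → cov μ f g = 0 →
      ∃ S : Set P, S ⊆ ↑s ∧ DetSupp μ f S ∧ DetSupp μ g Sᶜ ∧ Splits μ S := by
  induction s using Finset.strongInduction with
  | H s ih =>
  intro μ f g hμ0 hsupp hμ hf hg dμ df dg hcov
  have hμe : μ ∅ ≠ 0 := (hsupp ∅).2 (fun p q _ _ hq => absurd hq.1 (Set.notMem_empty q))
  -- the trivial case `s = ∅`
  rcases s.eq_empty_or_nonempty with hs | hs
  · refine ⟨∅, Set.empty_subset _, fun ω _ => ?_, fun ω _ => ?_, Splits.of_detBy fun ω => ?_⟩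
    · have := df ω
      rwa [hs, Finset.coe_empty] at this
    · rw [Set.compl_empty, Set.inter_univ]
    · have := dμ ω
      rwa [hs, Finset.coe_empty] at this
  -- a maximal live coordinate `l`; removing it preserves the support
  obtain ⟨l, hl⟩ := s.exists_maximal hs
  have hls : l ∈ s := hl.1
  have hlmax : ∀ q ∈ s, l ≤ q → q = l := fun q hq hlq => le_antisymm (hl.2 hq hlq) hlq
  have hrem : ∀ ω, μ ω ≠ 0 → μ (ω \ {l}) ≠ 0 := by
    intro ω hω
    rw [hsupp] at hω ⊢
    intro p q hp hpq hq
    have hpω := hω hp hpq ⟨hq.1.1, hq.2⟩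
    refine ⟨⟨hpω.1, fun hpl => ?_⟩, hp⟩
    rw [Set.mem_singleton_iff] at hpl
    rw [hpl] at hpq
    exact hq.1.2 (Set.mem_singleton_iff.2 (hlmax q hq.2 hpq))
  have hcoe : (↑(s.erase l) : Set P) = ↑s \ {l} := Finset.coe_erase l s
  have hsupp0 : ∀ ω, dnSec l μ ω ≠ 0 ↔ IsLowerIn ↑(s.erase l) (ω ∩ ↑(s.erase l)) := by
    intro ω
    rw [dnSec_eq, hsupp, hcoe]
    have e : (ω \ {l}) ∩ ↑s = ω ∩ (↑s \ {l}) := by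
      ext x; simp only [Set.mem_inter_iff, Set.mem_sdiff]; tauto
    rw [e]
    constructor
    · intro h p q hp hpq hq
      exact h hp.1 hpq hq
    · intro h p q hp hpq hq
      by_cases hpl : p = l
      · exfalso
        rw [hpl] at hpq
        exact hq.2.2 (Set.mem_singleton_iff.2 (hlmax q hq.2.1 hpq))
      · exact h ⟨hp, fun h' => hpl (Set.mem_singleton_iff.1 h')⟩ hpq hq
  -- the argument once a cross factor is known to vanish (stated for an arbitrary ordered pair `(f, g)`)
  have key : ∀ f g : Set P → ℝ, MonoSupp μ f → MonoSupp μ g → DetBy f ↑s → DetBy g ↑s → cov μ f g = 0 →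
      (∀ ω, upSec l μ ω ≠ 0 → upSec l f ω = dnSec l f ω) → cov (dnSec l μ) (dnSec l f) (ratio l μ) = 0 →
      ∃ S : Set P, S ⊆ ↑s ∧ DetSupp μ f S ∧ DetSupp μ g Sᶜ ∧ Splits μ S := by
    intro f g hf hg df dg hcov hfl hcovρ
    -- Step 2: induction hypothesis on `s ∖ {l}` for the lower section, `f(· ∖ {l})` and the ratio
    obtain ⟨S', hS's, dfS', dρS', hsplit'⟩ := ih (s.erase l) (Finset.erase_ssubset hls) (dnSec l μ)
      (dnSec l f) (ratio l μ) (fun ω => hμ0 _) hsupp0 (isLogSupermodular_dnSec hμ l) (monoSupp_dnSec hf l)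
      (monoSupp_ratio hμ0 hμ l) (hcoe ▸ detBy_dnSec dμ l) (hcoe ▸ detBy_dnSec df l)
      (hcoe ▸ detBy_ratio dμ l) hcovρ
    have hlS' : l ∉ S' := fun h => by
      have := hS's h
      rw [hcoe] at this
      exact this.2 rfl
    have hS'sub : S' ⊆ ↑s := hS's.trans (hcoe ▸ Set.sdiff_subset)
    -- `f` is `S'`-determined on the support of `μ`
    have dfS'μ : DetSupp μ f S' := by
      intro ω hω
      have h1 : f ω = f (ω \ {l}) := by
        by_cases hlω : l ∈ ω
        · have := hfl ω (by rw [upSec_eq, Set.insert_eq_of_mem hlω]; exact hω)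
          rwa [upSec_eq, dnSec_eq, Set.insert_eq_of_mem hlω] at this
        · rw [Set.sdiff_singleton_eq_self hlω]
      have h2 := dfS' ω (hrem ω hω)
      rw [dnSec_eq, dnSec_eq] at h2
      have e : (ω ∩ S') \ {l} = ω ∩ S' := Set.sdiff_singleton_eq_self fun h => hlS' h.2
      rw [h1, h2, e]
    -- Step 3: `μ` splits along `S'`
    have hsplitμ : Splits μ S' := by
      rw [eq_dnSec_mul_ratio hrem]
      refine splits_mul_detSupp_compl hsplit' fun ω hω => ?_
      have hmem : l ∈ ω ∩ S'ᶜ ↔ l ∈ ω := ⟨fun h => h.1, fun h => ⟨h, hlS'⟩⟩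
      by_cases hlω : l ∈ ω
      · rw [if_pos hlω, if_pos (hmem.2 hlω)]; exact dρS' ω hω
      · rw [if_neg hlω, if_neg (fun h => hlω (hmem.1 h))]
    -- Step 4: the fibres over the coordinates off `S'`
    obtain ⟨φ, hφdef⟩ : ∃ φ : Set P → ℝ, φ = fun ω => μ (ω ∩ S') := ⟨_, rfl⟩
    obtain ⟨ψ, hψdef⟩ : ∃ ψ : Set P → ℝ, ψ = fun ω => μ (ω \ S') / μ ∅ := ⟨_, rfl⟩
    have hφapp : ∀ ω, φ ω = μ (ω ∩ S') := fun ω => by rw [hφdef]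
    have hψapp : ∀ ω, ψ ω = μ (ω \ S') / μ ∅ := fun ω => by rw [hψdef]
    have hμφψ : ∀ ω, μ ω = φ ω * ψ ω := fun ω => by
      rw [hφapp, hψapp, mul_div_assoc', eq_div_iff hμe, hsplitμ.apply_mul_empty ω]
    have hφ0 : ∀ ω, 0 ≤ φ ω := fun ω => by rw [hφapp]; exact hμ0 _
    have hψ0 : ∀ ω, 0 ≤ ψ ω := fun ω => by rw [hψapp]; exact div_nonneg (hμ0 _) (hμ0 _)
    have hφe : φ ∅ ≠ 0 := by rwa [hφapp, Set.empty_inter]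
    have hφS' : DetBy φ S' := fun ω => by rw [hφapp, hφapp, Set.inter_assoc, Set.inter_self]
    have hψS' : DetBy ψ S'ᶜ := fun ω => by
      have e : (ω ∩ S'ᶜ) \ S' = ω \ S' := by
        ext x; simp only [Set.mem_sdiff, Set.mem_inter_iff, Set.mem_compl_iff]; tauto
      rw [hψapp, hψapp, e]
    have hφlsm : IsLogSupermodular φ := fun a b => by
      rw [hφapp, hφapp, hφapp, hφapp]
      have h := hμ (a ∩ S') (b ∩ S')
      have e1 : (a ∩ S') ⊓ (b ∩ S') = (a ⊓ b) ∩ S' := by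
        show (a ∩ S') ∩ (b ∩ S') = (a ∩ b) ∩ S'
        ext x; simp only [Set.mem_inter_iff]; tauto
      have e2 : (a ∩ S') ⊔ (b ∩ S') = (a ⊔ b) ∩ S' := by
        show (a ∩ S') ∪ (b ∩ S') = (a ∪ b) ∩ S'
        ext x; simp only [Set.mem_inter_iff, Set.mem_union]; tauto
      rwa [e1, e2] at h
    have hφne : ∀ ω, φ ω ≠ 0 ↔ μ (ω ∩ S') ≠ 0 := fun ω => by rw [hφapp]
    have hμne : ∀ ω, μ ω ≠ 0 → φ ω ≠ 0 ∧ ψ ω ≠ 0 := fun ω hω => by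
      have : φ ω * ψ ω ≠ 0 := by rw [← hμφψ]; exact hω
      exact ⟨left_ne_zero_of_mul this, right_ne_zero_of_mul this⟩
    have hmixne : ∀ ω β, φ ω ≠ 0 → ψ β ≠ 0 → μ (mix S' ω β) ≠ 0 := fun ω β hω hβ => by
      rw [hμφψ, hφS' (mix S' ω β), mix_inter, ← hφS' ω, hψS' (mix S' ω β), mix_inter_compl, ← hψS' β]
      exact mul_ne_zero hω hβ
    -- the `S'`-projection of `f` and the fibre functions of `g`
    obtain ⟨fh, hfhdef⟩ : ∃ fh : Set P → ℝ, fh = fun ω => f (ω ∩ S') := ⟨_, rfl⟩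
    have hfhapp : ∀ ω, fh ω = f (ω ∩ S') := fun ω => by rw [hfhdef]
    have hfh_eq : ∀ ω, μ ω ≠ 0 → f ω = fh ω := fun ω hω => by rw [hfhapp]; exact dfS'μ ω hω
    have hfh_det : DetBy fh S' := fun ω => by rw [hfhapp, hfhapp, Set.inter_assoc, Set.inter_self]
    have hfh_mono : MonoSupp φ fh := fun a b ha hb hab => by
      rw [hfhapp, hfhapp]
      exact hf ((hφne a).1 ha) ((hφne b).1 hb) (Set.inter_subset_inter_left _ hab)
    obtain ⟨gs, hgsdef⟩ : ∃ gs : Set P → Set P → ℝ, gs = fun β ω => g (mix S' ω β) := ⟨_, rfl⟩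
    have hgsapp : ∀ β ω, gs β ω = g (mix S' ω β) := fun β ω => by rw [hgsdef]
    have hgs_mono : ∀ β, ψ β ≠ 0 → MonoSupp φ (gs β) := fun β hβ a b ha hb hab => by
      rw [hgsapp, hgsapp]
      exact hg (hmixne a β ha hβ) (hmixne b β hb hβ) (mix_mono_left S' hab β)
    have hgs_det : ∀ β, DetBy (gs β) S' := fun β ω => by rw [hgsapp, hgsapp, mix_inter_self_left]
    have hgs_fun : ∀ β, (fun ω => g (mix S' ω β)) = gs β := fun β => funext fun ω => (hgsapp β ω).symm
    -- every fibre with nonzero weight has vanishing covariance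
    have hcov' : cov μ fh g = 0 := by rw [← cov_congr_supp hfh_eq]; exact hcov
    have hcovβ : ∀ β, ψ β ≠ 0 → cov φ fh (gs β) = 0 := by
      have hid := sum_cov_fibre (g := g) hμφψ hφS' hψS' hfh_det
      rw [hcov', mul_zero] at hid
      simp only [hgs_fun] at hid
      have hμe' : 0 < μ ∅ := lt_of_le_of_ne (hμ0 _) hμe.symm
      have hΨ : 0 < ∑ β, ψ β := by
        refine sum_pos' (fun β _ => hψ0 β) ⟨∅, mem_univ _, ?_⟩
        rw [hψapp, Set.empty_sdiff]
        exact div_pos hμe' hμe'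
      have hsum0 : ∑ β, ψ β * cov φ fh (gs β) = 0 := by
        rcases mul_eq_zero.1 hid with h | h
        · exact absurd h hΨ.ne'
        · exact h
      have hnn : ∀ β ∈ (univ : Finset (Set P)), 0 ≤ ψ β * cov φ fh (gs β) := fun β _ => by
        by_cases hβ : ψ β = 0
        · rw [hβ, zero_mul]
        · exact mul_nonneg (hψ0 β) (cov_nonneg_supp hφ0 hφlsm hfh_mono (hgs_mono β hβ))
      intro β hβ
      have := (sum_eq_zero_iff_of_nonneg hnn).1 hsum0 β (mem_univ β)
      rcases mul_eq_zero.1 this with h | h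
      · exact absurd h hβ
      · exact h
    -- Step 5: induction hypothesis on `S'` for every fibre with nonzero weight
    obtain ⟨t, htdef⟩ : ∃ t : Finset P, t = s.filter (fun i => i ∈ S') := ⟨_, rfl⟩
    have htcoe : (↑t : Set P) = S' := by
      ext i
      rw [htdef, Finset.coe_filter, Set.mem_setOf_eq]
      exact ⟨fun h => h.2, fun h => ⟨hS'sub h, h⟩⟩
    have hts : t ⊂ s := by rw [htdef]; exact Finset.filter_ssubset.2 ⟨l, hls, hlS'⟩
    -- `S'` is down-closed in `s` (because `μ` splits along it), so `φ` has the right support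
    have hS'low : ∀ ⦃p q : P⦄, p ∈ (↑s : Set P) → p ≤ q → q ∈ S' → p ∈ S' := by
      intro p q hp hpq hq
      have hω : μ {r | r ∈ (↑s : Set P) ∧ r ≤ q} ≠ 0 :=
        (hsupp _).2 fun a b ha hab hb => ⟨⟨ha, hab.trans hb.1.2⟩, ha⟩
      have h1 := (splits_supp_inter_diff hsplitμ hμe hω).1
      rw [hsupp] at h1
      have hq' : q ∈ {r | r ∈ (↑s : Set P) ∧ r ≤ q} ∩ S' ∩ ↑s := ⟨⟨⟨hS'sub hq, le_rfl⟩, hq⟩, hS'sub hq⟩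
      exact (h1 hp hpq hq').1.2
    have hsuppφ : ∀ ω, φ ω ≠ 0 ↔ IsLowerIn ↑t (ω ∩ ↑t) := by
      intro ω
      rw [hφne, hsupp, htcoe]
      have e : ω ∩ S' ∩ ↑s = ω ∩ S' := Set.inter_eq_left.2 (Set.inter_subset_right.trans hS'sub)
      rw [e]
      constructor
      · intro h p q hp hpq hq
        exact h (hS'sub hp) hpq hq
      · intro h p q hp hpq hq
        exact h (hS'low hp hpq hq.2) hpq hq
    have hfib : ∀ β, ∃ T : Set P, T ⊆ S' ∧ DetSupp φ fh T ∧ Splits φ T ∧ (ψ β ≠ 0 → DetSupp φ (gs β) Tᶜ) := by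
      intro β
      by_cases hβ : ψ β = 0
      · exact ⟨S', subset_rfl, detSupp_of_detBy hfh_det φ, Splits.of_detBy hφS', fun h => absurd hβ h⟩
      · have := ih t hts φ fh (gs β) hφ0 hsuppφ hφlsm hfh_mono (hgs_mono β hβ) (htcoe ▸ hφS')
          (htcoe ▸ hfh_det) (htcoe ▸ hgs_det β) (hcovβ β hβ)
        rw [htcoe] at this
        obtain ⟨T, hT1, hT2, hT3, hT4⟩ := this
        exact ⟨T, hT1, hT2, hT4, fun _ => hT3⟩
    choose T hTS' hfT hφT hgT using hfib
    -- Step 6: intersect over all fibres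
    have hfin : ∀ B : Finset (Set P), DetSupp φ fh (⋂ β ∈ B, T β) ∧ Splits φ (⋂ β ∈ B, T β) := by
      intro B
      induction B using Finset.induction_on with
      | empty =>
        simp only [Finset.notMem_empty, Set.iInter_of_empty, Set.iInter_univ]
        exact ⟨detSupp_of_detBy (DetBy.univ fh) φ, Splits.of_detBy (DetBy.univ φ)⟩
      | insert b B hb ihB =>
        rw [Finset.set_biInter_insert]
        exact ⟨(hfT b).inter ihB.1 ihB.2 hφe, splits_inter hφe (hφT b) ihB.2⟩
    obtain ⟨S, hSdef⟩ : ∃ S : Set P, S = ⋂ β, T β := ⟨_, rfl⟩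
    have hSuniv : (⋂ β ∈ (univ : Finset (Set P)), T β) = S := by
      simp only [mem_univ, Set.iInter_true, hSdef]
    obtain ⟨hfS, hφS⟩ := hfin univ
    rw [hSuniv] at hfS hφS
    have hST : ∀ β, S ⊆ T β := fun β => hSdef ▸ Set.iInter_subset _ β
    have hSS' : S ⊆ S' := (hST ∅).trans (hTS' ∅)
    refine ⟨S, hSS'.trans hS'sub, fun ω hω => ?_, fun ω hω => ?_, ?_⟩
    · -- `f` is `S`-determined on the support
      rw [hfh_eq ω hω, hfS ω (hμne ω hω).1, hfhapp, Set.inter_assoc, Set.inter_eq_left.2 hSS']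
    · -- `g` is `Sᶜ`-determined on the support
      obtain ⟨hφω, hψω⟩ := hμne ω hω
      have h1 : g ω = gs ω ω := by rw [hgsapp, mix_self]
      have h2 : gs ω (ω ∩ Sᶜ) = g (ω ∩ Sᶜ) := by
        rw [hgsapp, mix_congr_right S' (ω ∩ Sᶜ) (β' := ω ∩ Sᶜ) ?_, mix_self]
        ext x
        simp only [Set.mem_sdiff, Set.mem_inter_iff, Set.mem_compl_iff]
        exact ⟨fun h => ⟨⟨h.1, fun hx => h.2 (hSS' hx)⟩, h.2⟩, fun h => ⟨h.1.1, h.2⟩⟩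
      have hφω' : φ (ω ∩ Sᶜ) ≠ 0 := by
        rw [← Set.sdiff_eq]
        exact (splits_supp_inter_diff hφS hφe hφω).2
      have e : ω ∩ Sᶜ ∩ (T ω)ᶜ = ω ∩ (T ω)ᶜ := by
        ext x
        simp only [Set.mem_inter_iff, Set.mem_compl_iff]
        exact ⟨fun h => ⟨h.1.1, h.2⟩, fun h => ⟨⟨h.1, fun hx => h.2 (hST ω hx)⟩, h.2⟩⟩
      rw [h1, hgT ω hψω ω hφω, ← e, ← hgT ω hψω (ω ∩ Sᶜ) hφω', h2]
    · -- `μ = φ·ψ` splits along `S`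
      have : μ = fun ω => φ ω * ψ ω := funext hμφψ
      rw [this]
      exact hφS.mul_detBy_compl (hψS'.mono (Set.compl_subset_compl.2 hSS'))
  -- the dichotomy: a cross factor vanishes for `f` or for `g`
  rcases cross_factor_dichotomy hμ0 hμ hrem hf hg hcov with ⟨hfl, hcovρ⟩ | ⟨hgl, hcovρ⟩
  · exact key f g hf hg df dg hcov hfl hcovρ
  · obtain ⟨S₁, hS₁s, dgS₁, dfS₁, hsplit₁⟩ :=
      key g f hg hf dg df (by rw [cov_comm]; exact hcov) hgl hcovρ
    refine ⟨↑s \ S₁, Set.sdiff_subset, fun ω hω => ?_, fun ω hω => ?_, ?_⟩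
    · rw [dfS₁ ω hω, df (ω ∩ S₁ᶜ), Set.inter_assoc, Set.sdiff_eq_compl_inter]
    · have e : (↑s \ S₁)ᶜ ∩ (↑s : Set P) = S₁ := by
        ext x
        constructor
        · rintro ⟨h1, h2⟩
          by_contra hx
          exact h1 ⟨h2, hx⟩
        · intro hx
          exact ⟨fun h => h.2 hx, hS₁s hx⟩
      rw [dgS₁ ω hω, dg (ω ∩ (↑s \ S₁)ᶜ), Set.inter_assoc, e]
    · rw [Set.sdiff_eq_compl_inter]
      exact splits_inter_of_detBy (splits_compl hsplit₁) dμ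


omit [Fintype P] in
/-- A set of coordinates along which a weight with support `𝓛(P)` splits is DOWN-closed.
[cite: ChanPak2026, Thm. 1.6 (the factor lattices `L₁`, `L₂`)] -/
theorem splits_isLowerSet {μ : Set P → ℝ} (hsupp : ∀ ω, μ ω ≠ 0 ↔ IsLowerSet ω) {S : Set P}
    (hS : Splits μ S) : IsLowerSet S := by
  intro q p hpq hq
  have hμe : μ ∅ ≠ 0 := (hsupp ∅).2 isLowerSet_empty
  have hω : μ (Set.Iic q) ≠ 0 := (hsupp _).2 (isLowerSet_Iic q)
  have h1 := (hsupp _).1 (splits_supp_inter_diff hS hμe hω).1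
  exact (h1 hpq ⟨Set.mem_Iic.2 le_rfl, hq⟩).2

omit [Fintype P] in
/-- A set of coordinates along which a weight with support `𝓛(P)` splits is UP-closed.
[cite: ChanPak2026, Thm. 1.6 (the factor lattices `L₁`, `L₂`)] -/
theorem splits_isUpperSet {μ : Set P → ℝ} (hsupp : ∀ ω, μ ω ≠ 0 ↔ IsLowerSet ω) {S : Set P}
    (hS : Splits μ S) : IsUpperSet S := by
  intro q p hqp hq
  have hμe : μ ∅ ≠ 0 := (hsupp ∅).2 isLowerSet_empty
  have hω : μ (Set.Iic p) ≠ 0 := (hsupp _).2 (isLowerSet_Iic p)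
  have h1 := (hsupp _).1 (splits_supp_inter_diff hS hμe hω).2
  by_contra hp
  exact (h1 hqp ⟨Set.mem_Iic.2 le_rfl, hp⟩).2 hq

/-- **Equality in FKG on the lattice `𝓛(P)` of lower sets of a finite poset**, realised inside `2^P` as a
nonnegative log-supermodular weight whose support is exactly `𝓛(P)`: `Ω(f,g) = 0` for `f, g` increasing on
`𝓛(P)` forces a set `S` of coordinates, both down- and up-closed (so that `𝓛(P) ≅ 𝓛(S) × 𝓛(P ∖ S)`), with `f`
determined by `S`, `g` by `Sᶜ`, and `μ` splitting along `S`. [cite: ChanPak2026, Thm. 1.6 and Rem. 1.7] -/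
theorem exists_split_of_cov_eq_zero_supp {μ f g : Set P → ℝ} (hμ0 : ∀ ω, 0 ≤ μ ω)
    (hsupp : ∀ ω, μ ω ≠ 0 ↔ IsLowerSet ω) (hμ : IsLogSupermodular μ) (hf : MonoSupp μ f) (hg : MonoSupp μ g)
    (hcov : cov μ f g = 0) :
    ∃ S : Set P, IsLowerSet S ∧ IsUpperSet S ∧ DetSupp μ f S ∧ DetSupp μ g Sᶜ ∧ Splits μ S := by
  have hsupp' : ∀ ω, μ ω ≠ 0 ↔ IsLowerIn ↑(Finset.univ : Finset P) (ω ∩ ↑(Finset.univ : Finset P)) := by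
    intro ω
    rw [hsupp, Finset.coe_univ, Set.inter_univ]
    exact ⟨fun h p q _ hpq hq => h hpq hq, fun h q p hpq hq => h (Set.mem_univ p) hpq hq⟩
  obtain ⟨S, -, h1, h2, h3⟩ := exists_split_of_cov_eq_zero_supp_aux Finset.univ μ f g hμ0 hsupp' hμ hf hg
    (by rw [Finset.coe_univ]; exact DetBy.univ μ) (by rw [Finset.coe_univ]; exact DetBy.univ f)
    (by rw [Finset.coe_univ]; exact DetBy.univ g) hcov
  exact ⟨S, splits_isLowerSet hsupp h3, splits_isUpperSet hsupp h3, h1, h2, h3⟩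

/-! ### `𝓛(P) ≅ 𝓛(S) × 𝓛(P ∖ S)` for a biclosed `S` -/

omit [Fintype P] in
/-- The image in `P` of a lower set of a down-closed `S ⊆ P` is a lower set. [folklore] -/
private theorem isLowerSet_image_val {S : Set P} (hS : IsLowerSet S) (A : LowerSet S) :
    IsLowerSet (Subtype.val '' (A : Set S)) := by
  rintro a b hba ⟨a', ha', rfl⟩
  exact ⟨⟨b, hS hba a'.2⟩, A.lower (show (⟨b, hS hba a'.2⟩ : S) ≤ a' from hba) ha', rfl⟩

omit [Fintype P] in
/-- For `S ⊆ P` down- and up-closed, `P` is the disjoint union of the posets `S` and `P ∖ S` with no comparabilities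
between them, so `𝓛(P) ≃o 𝓛(S) × 𝓛(P ∖ S)` — the lattice isomorphism `L ≃ L₁ × L₂` of [ChanPak2026, Thm. 1.6].
[cite: ChanPak2026, Thm. 1.6] -/
def lowerSetProdIso (S : Set P) (hSl : IsLowerSet S) (hSu : IsUpperSet S) :
    LowerSet P ≃o LowerSet S × LowerSet ↥Sᶜ where
  toFun D := (⟨Subtype.val ⁻¹' (D : Set P), D.lower.preimage (Subtype.mono_coe S)⟩,
    ⟨Subtype.val ⁻¹' (D : Set P), D.lower.preimage (Subtype.mono_coe Sᶜ)⟩)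
  invFun p := ⟨{x | (∀ h : x ∈ S, (⟨x, h⟩ : S) ∈ p.1) ∧ ∀ h : x ∈ Sᶜ, (⟨x, h⟩ : ↥Sᶜ) ∈ p.2}, by
    rintro a b hba ⟨ha1, ha2⟩
    by_cases ha : a ∈ S
    · have hb : b ∈ S := hSl hba ha
      exact ⟨fun h => p.1.lower (show (⟨b, h⟩ : S) ≤ ⟨a, ha⟩ from hba) (ha1 ha), fun h => absurd hb h⟩
    · have hb : b ∉ S := fun hb => ha (hSu hba hb)
      exact ⟨fun h => absurd h hb, fun h => p.2.lower (show (⟨b, h⟩ : ↥Sᶜ) ≤ ⟨a, ha⟩ from hba) (ha2 ha)⟩⟩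
  left_inv D := by
    ext x
    simp only [LowerSet.coe_mk, Set.mem_setOf_eq, SetLike.mem_coe]
    by_cases hx : x ∈ S
    · exact ⟨fun h => h.1 hx, fun h => ⟨fun _ => h, fun h' => absurd hx h'⟩⟩
    · exact ⟨fun h => h.2 hx, fun h => ⟨fun h' => absurd h' hx, fun _ => h⟩⟩
  right_inv p := by
    ext ⟨x, hx⟩
    · simp only [LowerSet.coe_mk, Set.mem_preimage, Set.mem_setOf_eq, SetLike.mem_coe]
      exact ⟨fun h => h.1 hx, fun h => ⟨fun _ => h, fun h' => absurd hx h'⟩⟩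
    · simp only [LowerSet.coe_mk, Set.mem_preimage, Set.mem_setOf_eq, SetLike.mem_coe]
      exact ⟨fun h => h.2 hx, fun h => ⟨fun h' => absurd h' hx, fun _ => h⟩⟩
  map_rel_iff' := by
    intro D D'
    constructor
    · rintro ⟨h1, h2⟩ x hx
      by_cases hxS : x ∈ S
      · exact h1 (show (⟨x, hxS⟩ : S) ∈ Subtype.val ⁻¹' (D : Set P) from hx)
      · exact h2 (show (⟨x, hxS⟩ : ↥Sᶜ) ∈ Subtype.val ⁻¹' (D : Set P) from hx)
    · intro h
      exact ⟨fun y hy => h hy, fun y hy => h hy⟩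

end Poset

/-! ### Chan–Pak's Theorem 1.6 for an abstract finite distributive lattice -/

section Lattice

universe u

variable {L : Type u} [DistribLattice L] [Fintype L]

/-- `L ≃o L × PUnit` (used for the degenerate empty lattice). [folklore] -/
private def prodPUnitIso (L : Type u) [LE L] : L ≃o L × PUnit.{u+1} where
  toFun x := (x, PUnit.unit)
  invFun p := p.1
  left_inv _ := rfl
  right_inv _ := rfl
  map_rel_iff' := by
    intro a b
    exact Prod.mk_le_mk.trans (and_iff_left le_rfl)

/-- **The converse direction of [ChanPak2026, Thm. 1.6]** ("clear"): if `L ≃ L₁ × L₂` with `f` a function of the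
first coordinate, `g` of the second and `μ = μ₁ ⊗ μ₂`, then (FKG) is an equality — for ANY weight.
[cite: ChanPak2026, Thm. 1.6 (⇐)] -/
theorem fkg_eq_of_prod {L₁ L₂ : Type*} [Fintype L₁] [Fintype L₂] [LE L₁] [LE L₂]
    (e : L ≃o L₁ × L₂) {μ f g : L → ℝ} {f' μ₁ : L₁ → ℝ} {g' μ₂ : L₂ → ℝ}
    (hf : ∀ x, f x = f' (e x).1) (hg : ∀ x, g x = g' (e x).2) (hμ : ∀ x, μ x = μ₁ (e x).1 * μ₂ (e x).2) :
    (∑ x, μ x * f x) * (∑ x, μ x * g x) = (∑ x, μ x * (f x * g x)) * ∑ x, μ x := by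
  have tr : ∀ (F : L₁ × L₂ → ℝ), ∑ x, F (e x) = ∑ p : L₁ × L₂, F p := fun F =>
    Fintype.sum_equiv e.toEquiv (fun x => F (e x)) F fun x => rfl
  have h1 : ∑ x, μ x * f x = (∑ y, μ₁ y * f' y) * ∑ z, μ₂ z :=
    calc ∑ x, μ x * f x = ∑ x, (fun p : L₁ × L₂ => μ₁ p.1 * f' p.1 * μ₂ p.2) (e x) :=
          Fintype.sum_congr _ _ fun x => by beta_reduce; rw [hμ, hf]; ring
      _ = ∑ p : L₁ × L₂, μ₁ p.1 * f' p.1 * μ₂ p.2 := tr (fun p => μ₁ p.1 * f' p.1 * μ₂ p.2)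
      _ = (∑ y, μ₁ y * f' y) * ∑ z, μ₂ z := by rw [Fintype.sum_prod_type, sum_mul_sum]
  have h2 : ∑ x, μ x * g x = (∑ y, μ₁ y) * ∑ z, μ₂ z * g' z :=
    calc ∑ x, μ x * g x = ∑ x, (fun p : L₁ × L₂ => μ₁ p.1 * (μ₂ p.2 * g' p.2)) (e x) :=
          Fintype.sum_congr _ _ fun x => by beta_reduce; rw [hμ, hg]; ring
      _ = ∑ p : L₁ × L₂, μ₁ p.1 * (μ₂ p.2 * g' p.2) := tr (fun p => μ₁ p.1 * (μ₂ p.2 * g' p.2))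
      _ = (∑ y, μ₁ y) * ∑ z, μ₂ z * g' z := by rw [Fintype.sum_prod_type, sum_mul_sum]
  have h3 : ∑ x, μ x * (f x * g x) = (∑ y, μ₁ y * f' y) * ∑ z, μ₂ z * g' z :=
    calc ∑ x, μ x * (f x * g x) = ∑ x, (fun p : L₁ × L₂ => μ₁ p.1 * f' p.1 * (μ₂ p.2 * g' p.2)) (e x) :=
          Fintype.sum_congr _ _ fun x => by beta_reduce; rw [hμ, hf, hg]; ring
      _ = ∑ p : L₁ × L₂, μ₁ p.1 * f' p.1 * (μ₂ p.2 * g' p.2) :=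
          tr (fun p => μ₁ p.1 * f' p.1 * (μ₂ p.2 * g' p.2))
      _ = (∑ y, μ₁ y * f' y) * ∑ z, μ₂ z * g' z := by rw [Fintype.sum_prod_type, sum_mul_sum]
  have h4 : ∑ x, μ x = (∑ y, μ₁ y) * ∑ z, μ₂ z :=
    calc ∑ x, μ x = ∑ x, (fun p : L₁ × L₂ => μ₁ p.1 * μ₂ p.2) (e x) :=
          Fintype.sum_congr _ _ fun x => by beta_reduce; rw [hμ]
      _ = ∑ p : L₁ × L₂, μ₁ p.1 * μ₂ p.2 := tr (fun p => μ₁ p.1 * μ₂ p.2)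
      _ = (∑ y, μ₁ y) * ∑ z, μ₂ z := by rw [Fintype.sum_prod_type, sum_mul_sum]
  rw [h1, h2, h3, h4]; ring

/-- **Chan–Pak 2026, Theorem 1.6 (equality conditions for the FKG inequality), verbatim.**  For a finite
distributive lattice `L`, a strictly positive log-supermodular `μ : L → ℝ` and increasing `f, g : L → ℝ`,
`Σμf · Σμg = Σμfg · Σμ` holds iff there are distributive lattices `L₁, L₂` and a lattice isomorphism
`L ≃ L₁ × L₂` under which `f(x₁,x₂) = f'(x₁)`, `g(x₁,x₂) = g'(x₂)` (1.4) and `μ(x₁,x₂) = μ₁(x₁)μ₂(x₂)` with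
`μ₁, μ₂ > 0` (1.5).  (An order isomorphism of lattices preserves `∨, ∧`: `OrderIso.map_sup`, `OrderIso.map_inf`.)
Proof: Birkhoff (`OrderIso.lowerSetSupIrred`) + `exists_split_of_cov_eq_zero_supp` + `lowerSetProdIso`; the printed
proof goes through the equality theorem for Ahlswede–Daykin instead. [cite: ChanPak2026, Thm. 1.6] -/
theorem fkg_eq_iff_exists_prod (μ f g : L → ℝ) (hpos : ∀ x, 0 < μ x)
    (hμ : ∀ a b, μ a * μ b ≤ μ (a ⊓ b) * μ (a ⊔ b)) (hf : Monotone f) (hg : Monotone g) :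
    (∑ x, μ x * f x) * (∑ x, μ x * g x) = (∑ x, μ x * (f x * g x)) * ∑ x, μ x ↔
    ∃ (L₁ L₂ : Type u) (_ : DistribLattice L₁) (_ : Fintype L₁) (_ : DistribLattice L₂) (_ : Fintype L₂)
      (e : L ≃o L₁ × L₂) (f' : L₁ → ℝ) (g' : L₂ → ℝ) (μ₁ : L₁ → ℝ) (μ₂ : L₂ → ℝ),
      (∀ y, 0 < μ₁ y) ∧ (∀ z, 0 < μ₂ z) ∧ (∀ x, f x = f' (e x).1) ∧ (∀ x, g x = g' (e x).2) ∧
        ∀ x, μ x = μ₁ (e x).1 * μ₂ (e x).2 := by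
  refine ⟨fun heq => ?_, ?_⟩
  swap
  · rintro ⟨L₁, L₂, _, _, _, _, e, f', g', μ₁, μ₂, -, -, h1, h2, h3⟩
    exact fkg_eq_of_prod e h1 h2 h3
  -- the degenerate empty lattice
  rcases isEmpty_or_nonempty L with hL | hL
  · exact ⟨L, PUnit.{u+1}, inferInstance, inferInstance, inferInstance, inferInstance, prodPUnitIso L, f,
      fun _ => 0, μ, fun _ => 1, hpos, fun _ => one_pos, fun x => rfl, fun x => isEmptyElim x,
      fun x => (mul_one _).symm⟩
  -- Birkhoff: `L ≃o 𝓛(P)`, `P` = join-irreducibles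
  letI : OrderBot L := Fintype.toOrderBot L
  obtain ⟨P, _, _, e⟩ : ∃ (P : Type u) (_ : PartialOrder P) (_ : Fintype P), Nonempty (L ≃o LowerSet P) :=
    ⟨{a : L // SupIrred a}, inferInstance, inferInstance, ⟨OrderIso.lowerSetSupIrred⟩⟩
  obtain ⟨e⟩ := e
  -- transport of functions on `L` to functions on `2^P` vanishing off `𝓛(P)`
  obtain ⟨T, hT1, hT0⟩ : ∃ T : (L → ℝ) → Set P → ℝ,
      (∀ F ω (h : IsLowerSet ω), T F ω = F (e.symm ⟨ω, h⟩)) ∧ ∀ F ω, ¬IsLowerSet ω → T F ω = 0 :=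
    ⟨fun F ω => if h : IsLowerSet ω then F (e.symm ⟨ω, h⟩) else 0, fun F ω h => dif_pos h,
      fun F ω h => dif_neg h⟩
  have hTe : ∀ F x, T F (e x) = F x := fun F x => by
    rw [hT1 F _ (e x).lower]
    exact congrArg F (e.symm_apply_apply x)
  -- sums over `2^P` of functions vanishing off `𝓛(P)` are sums over `L`
  have hsum : ∀ G : Set P → ℝ, (∀ ω, ¬IsLowerSet ω → G ω = 0) → ∑ ω, G ω = ∑ x, G (e x) := by
    intro G hG
    rw [← Finset.sum_filter_of_ne (s := Finset.univ) (p := fun ω : Set P => IsLowerSet ω)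
      (fun ω _ hne => by by_contra h; exact hne (hG ω h))]
    symm
    refine Finset.sum_bij' (fun x _ => (e x : Set P)) (fun ω hω => e.symm ⟨ω, (Finset.mem_filter.1 hω).2⟩)
      (fun x _ => Finset.mem_filter.2 ⟨Finset.mem_univ _, (e x).lower⟩) (fun ω _ => Finset.mem_univ _)
      (fun x _ => ?_) (fun ω hω => ?_) (fun x _ => rfl)
    · exact e.symm_apply_apply x
    · simp only [OrderIso.apply_symm_apply, LowerSet.coe_mk]
  -- the transported data
  have hμ0 : ∀ ω, 0 ≤ T μ ω := fun ω => by
    by_cases h : IsLowerSet ω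
    · rw [hT1 μ ω h]; exact (hpos _).le
    · rw [hT0 μ ω h]
  have hsupp : ∀ ω, T μ ω ≠ 0 ↔ IsLowerSet ω := fun ω => by
    by_cases h : IsLowerSet ω
    · rw [hT1 μ ω h]; exact ⟨fun _ => h, fun _ => (hpos _).ne'⟩
    · rw [hT0 μ ω h]; exact ⟨fun h' => absurd rfl h', fun h' => absurd h' h⟩
  have hmk : ∀ (a b : Set P) (ha : IsLowerSet a) (hb : IsLowerSet b),
      (⟨a ∩ b, ha.inter hb⟩ : LowerSet P) = ⟨a, ha⟩ ⊓ ⟨b, hb⟩ ∧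
        (⟨a ∪ b, ha.union hb⟩ : LowerSet P) = ⟨a, ha⟩ ⊔ ⟨b, hb⟩ := fun a b ha hb =>
    ⟨LowerSet.ext (by rw [LowerSet.coe_inf]; rfl), LowerSet.ext (by rw [LowerSet.coe_sup]; rfl)⟩
  have hlsm : IsLogSupermodular (T μ) := by
    intro a b
    by_cases ha : IsLowerSet a
    swap
    · rw [hT0 μ a ha, zero_mul]; exact mul_nonneg (hμ0 _) (hμ0 _)
    by_cases hb : IsLowerSet b
    swap
    · rw [hT0 μ b hb, mul_zero]; exact mul_nonneg (hμ0 _) (hμ0 _)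
    show T μ a * T μ b ≤ T μ (a ∩ b) * T μ (a ∪ b)
    rw [hT1 μ a ha, hT1 μ b hb, hT1 μ _ (ha.inter hb), hT1 μ _ (ha.union hb), (hmk a b ha hb).1,
      (hmk a b ha hb).2, e.symm.map_inf, e.symm.map_sup]
    exact hμ _ _
  have hle : ∀ (a b : Set P) (ha : IsLowerSet a) (hb : IsLowerSet b), a ⊆ b →
      e.symm ⟨a, ha⟩ ≤ e.symm ⟨b, hb⟩ := fun a b ha hb hab =>
    e.symm.monotone (LowerSet.coe_subset_coe.1 hab)
  have hmono : ∀ F : L → ℝ, Monotone F → MonoSupp (T μ) (T F) := by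
    intro F hF a b ha hb hab
    rw [hsupp] at ha hb
    rw [hT1 F a ha, hT1 F b hb]
    exact hF (hle a b ha hb hab)
  have hprod : ∀ F G : L → ℝ, ∑ ω, T μ ω * (T F ω * T G ω) = ∑ x, μ x * (F x * G x) := by
    intro F G
    rw [hsum _ fun ω h => by rw [hT0 μ ω h, zero_mul]]
    exact Fintype.sum_congr _ _ fun x => by rw [hTe, hTe, hTe]
  have hlin : ∀ F : L → ℝ, ∑ ω, T μ ω * T F ω = ∑ x, μ x * F x := by
    intro F
    rw [hsum _ fun ω h => by rw [hT0 μ ω h, zero_mul]]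
    exact Fintype.sum_congr _ _ fun x => by rw [hTe, hTe]
  have hmass : ∑ ω, T μ ω = ∑ x, μ x := by
    rw [hsum _ fun ω h => hT0 μ ω h]
    exact Fintype.sum_congr _ _ fun x => hTe μ x
  have hcov : cov (T μ) (T f) (T g) = 0 := by
    rw [cov, ex, ex, ex]
    simp only [Pi.mul_apply]
    rw [hprod, hlin, hlin, hmass]
    linarith [heq]
  -- the split
  obtain ⟨S, hSl, hSu, dfS, dgS, hsplit⟩ :=
    exists_split_of_cov_eq_zero_supp hμ0 hsupp hlsm (hmono f hf) (hmono g hg) hcov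
  have hμe : T μ ∅ ≠ 0 := (hsupp ∅).2 isLowerSet_empty
  haveI : Finite (LowerSet S) := Finite.of_injective (fun A : LowerSet S => (A : Set S)) SetLike.coe_injective
  haveI : Finite (LowerSet ↥Sᶜ) :=
    Finite.of_injective (fun A : LowerSet ↥Sᶜ => (A : Set ↥Sᶜ)) SetLike.coe_injective
  letI : Fintype (LowerSet S) := Fintype.ofFinite _
  letI : Fintype (LowerSet ↥Sᶜ) := Fintype.ofFinite _
  have hSc : IsLowerSet Sᶜ := hSu.compl
  refine ⟨LowerSet S, LowerSet ↥Sᶜ, inferInstance, inferInstance, inferInstance, inferInstance,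
    e.trans (lowerSetProdIso S hSl hSu), fun A => T f (Subtype.val '' (A : Set S)),
    fun B => T g (Subtype.val '' (B : Set ↥Sᶜ)), fun A => T μ (Subtype.val '' (A : Set S)),
    fun B => T μ (Subtype.val '' (B : Set ↥Sᶜ)) / T μ ∅, fun A => ?_, fun B => ?_, fun x => ?_, fun x => ?_,
    fun x => ?_⟩
  · exact lt_of_le_of_ne (hμ0 _) ((hsupp _).2 (isLowerSet_image_val hSl A)).symm
  · exact div_pos (lt_of_le_of_ne (hμ0 _) ((hsupp _).2 (isLowerSet_image_val hSc B)).symm)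
      (lt_of_le_of_ne (hμ0 _) hμe.symm)
  · have hx : T μ (e x) ≠ 0 := by rw [hTe]; exact (hpos x).ne'
    show f x = T f (Subtype.val '' (Subtype.val ⁻¹' (e x : Set P)))
    rw [Subtype.image_preimage_coe, Set.inter_comm, ← dfS _ hx, hTe]
  · have hx : T μ (e x) ≠ 0 := by rw [hTe]; exact (hpos x).ne'
    show g x = T g (Subtype.val '' (Subtype.val ⁻¹' (e x : Set P)))
    rw [Subtype.image_preimage_coe, Set.inter_comm, ← dgS _ hx, hTe]
  · show μ x = T μ (Subtype.val '' (Subtype.val ⁻¹' (e x : Set P))) *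
      (T μ (Subtype.val '' (Subtype.val ⁻¹' (e x : Set P))) / T μ ∅)
    rw [Subtype.image_preimage_coe, Subtype.image_preimage_coe, Set.inter_comm, Set.inter_comm Sᶜ,
      ← Set.sdiff_eq, mul_div_assoc', eq_div_iff hμe, ← hsplit.apply_mul_empty, hTe]

end Lattice

end Literature.Probability.LatticeModels.FKGEqualityLattice
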